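import Literature.NumberTheory.EllipticCurves.Castella2018.Section5Bookkeeping
import Literature.NumberTheory.EllipticCurves.PastenSpectralDegreeIsogenyBoundProofs
import Literature.NumberTheory.EllipticCurves.LeadingTermHeegnerProofs
import Mathlib.Data.ZMod.QuotientGroup
import HarnessLib

/-!
# X11b, route R1 — SCALING of Heegner points in the tree's sense, and a degeneracy of the
# `∀ P, IsHeegnerPoint … P → …`-shaped Gross–Zagier paraphrase (Castella 2018 §5, link (B))

HONEST FRAMING (cell `b2b-bsdres`, verbatim): the goal of the cell is to DELETE the
COMBINATION-SHAPED residual classes for ALL analytic-rank `≤ 1` curves over `ℚ` — "full BSD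
formula for every rank `≤ 1` curve in class C" assembled STRICTLY from published theorems — so that
the rank-`≤ 1` remainder becomes exactly the CONSTRUCTION-SHAPED classes, which are TYPED
(missing-input `Prop`s), NOT attempted. This is not "finishing BSD". Literature seat (cell lead),
gen 14: a FAITHFULNESS finding on the wording of one cited input, with kernel evidence. No label
changes; nothing is booked; no new named fact.

## What this file proves (theorems only)

1. `heegnerPointComplex_eq_zsmul` / `isHeegnerPoint_zsmul`: the tree's notion
   `IsHeegnerPoint N W K P` (`HeegnerPoints.lean`: *some* parametrisation datum `Dt` of `W` at
   level `N`, some Heegner datum, some embedding, with `P ↦ ∑_{[Q]} φ_{Dt}(τ_Q)`) is CLOSED UNDER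
   NON-ZERO INTEGER MULTIPLES: if `P` is a Heegner point then so is `k • P` for every `k ≠ 0`.
   Reason: a datum only requires `c Λ_f ⊆ Λ_E` of its Manin constant `c`, so `k·c` is again an
   admissible constant (`ModularParametrizationData.exists_datum_c_eq`, tree theorem: the
   parametrisation `X₀(N) → ℂ/Λ_f → E` through `z ↦ k c z`), and `φ_{k c}(τ) = k • φ_c(τ)` because
   the uniformisation is additive.
2. `index_zmultiples_zsmul`: for `x` of infinite order in an additive commutative group and an
   integer `n`, `[G : ℤ(n•x)] = |n| · [G : ℤx]` (as `Nat.card` indices; elementary).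
3. `section5_grossZagierParaphrase_degenerate`: CONSEQUENTLY the named fact
   `Literature.…Castella2018.section5_grossZagierParaphrase` (p201349; Castella, Camb. J. Math. 6
   (2018) §5, link (B) of route R1), which concludes
   `ord_p(L'(E,1)/(Ω_E Reg)) + ord_p(L(E^D,1)/Ω_{E^D}) = 2·ord_p [E(K) : ℤP]` for EVERY `P` with
   `IsHeegnerPoint N_E W K P` of infinite order, can hold at an instance of its hypotheses only if
   `[E(K) : ℤP] = 0`, i.e. only if `E(K)/ℤP` is INFINITE: applied to `P` and to `p • P` (both
   Heegner points, item 1) it gives `2·ord_p[E(K):ℤP] = 2·ord_p[E(K):ℤ(p•P)] = 2·(ord_p[E(K):ℤP] + 1)`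
   whenever the index is a positive integer. In Castella's §5 setting `rank_ℤ E(K) = 1`
   (Gross–Zagier–Kolyvagin, as quoted in the fact's own docstring), so the index IS positive there:
   the fact as worded has no non-degenerate instance. The printed source is NOT at fault: Castella
   (following Jetchev–Skinner–Wan, Camb. J. Math. 5 (2017) §7.4, display before (7.22): "… =
   ⟨z_K, z_K⟩_{NT}/c_E², where c_E ∈ ℤ is the Manin constant of E (so p ∤ c_E in this case; see
   Remark 43)" — Mazur: `p ∤ 2ND ⇒ p ∤ c`) works with THE Heegner point of a parametrisation whose
   Manin constant is a `p`-adic unit; the tree's `IsHeegnerPoint` forgets the datum, hence the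
   constant. REPAIR (for the owners of `Section5Bookkeeping.lean` and of the X11b chain; not done
   here): state link (B) — and likewise the OPEN display (5.3) wherever it is quantified over all
   `IsHeegnerPoint` points, e.g. the hypothesis `hA` of `bsdp_semistable_of_display` — for a point
   `P` GIVEN WITH its datum `Dt` (`P ↦ heegnerPointComplex Dt H`) and `¬ (p : ℤ) ∣ Dt.c`, or keep
   the factor `c²` in the identity as the tree's `gross_zagier` / `CaiShuTian2014.thm11_trivialChar`
   do (those carry `Dt.c` inside `grossZagierConstant` and are scaling-consistent).

Nothing here asserts that any published theorem is false; the finding concerns the tree's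
TRANSCRIPTION of Cas18 §5 (B) only. Inequalities in the index (Kolyvagin, Cha 2005, Jetchev 2008,
Miller 2011 Thm. 5.4, Matar–Nekovář's `p ∤ index` hypothesis) are monotone under `P ↦ p•P` and are
NOT affected.

## References
* F. Castella, Camb. J. Math. 6 (2018) 1–23, §5 (arXiv:1704.06608 p. 12). [Castella2018]
* D. Jetchev, C. Skinner, X. Wan, Camb. J. Math. 5 (2017) 369–434, §7.4, Remark 43 and the display
  before (7.22) (arXiv:1512.06894 pp. 29–30). [JetchevSkinnerWan2017]
* B. Gross, *Heegner points on X₀(N)* (1984) §§3–4; B. Gross, D. Zagier, Invent. Math. 84 (1986)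
  I.§4, I.(6.1). [Gross1984] [GrossZagier1986]
* HOME/CITED-FACTS.md lit GEN 14 block, row A68; HOME/b2b-bsdres-lit/g14/.
-/

noncomputable section

open scoped Classical

open WeierstrassCurve NumberField Literature.NumberTheory.EllipticCurves
  Literature.NumberTheory.EllipticCurves.ModularForms
  Literature.NumberTheory.EllipticCurves.Rank1Residual

namespace Summit.BirchSwinnertonDyer.Rank1Residual.X11b

universe u

/-! ### 1. Heegner points in the tree's sense are closed under non-zero multiples -/

section Scaling

variable {W : WeierstrassCurve ℚ} {N : ℕ} [NeZero N]

/-- Two parametrisation data with the same newform and uniformisation and Manin constants `c` and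
`k·c` have Heegner points `P` and `k • P`: `φ_{k c}(τ) = uniformize (k c ∫f) = k • uniformize (c ∫f)`
(the uniformisation `ℂ →+ E(ℂ)` is additive), summed over the Heegner forms. [folklore] -/
theorem heegnerPointComplex_eq_zsmul (Dt Dk : ModularParametrizationData W N) (k : ℤ)
    (hf : Dk.f = Dt.f) (hu : Dk.uniformize = Dt.uniformize) (hc : Dk.c = k * Dt.c)
    {D : ℤ} (H : HeegnerDatum N D) :
    heegnerPointComplex Dk H = k • heegnerPointComplex Dt H := by
  unfold heegnerPointComplex
  rw [Finset.smul_sum]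
  refine Finset.sum_congr rfl fun Q _ ↦ ?_
  show Dk.uniformize ((Dk.c : ℂ) * eichlerIntegral Dk.f (heegnerTau Q)) =
    k • Dt.uniformize ((Dt.c : ℂ) * eichlerIntegral Dt.f (heegnerTau Q))
  rw [hu, hf, hc, ← map_zsmul Dt.uniformize k, zsmul_eq_mul]
  push_cast
  ring_nf

/-- **Heegner points (tree sense) are closed under non-zero integer multiples.** If
`IsHeegnerPoint N W K P` then `IsHeegnerPoint N W K (k • P)` for every integer `k ≠ 0`: the datum
with Manin constant `k·c` (`ModularParametrizationData.exists_datum_c_eq`; `k c Λ_f ⊆ Λ_E` because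
`Λ_E` is a `ℤ`-module) has Heegner point `k • P` (`heegnerPointComplex_eq_zsmul`), and
`E(K) → E(ℂ)` is additive. [folklore] -/
theorem isHeegnerPoint_zsmul {K : Type u} [Field K] [NumberField K]
    {P : (W.baseChange K).toAffine.Point} (hP : IsHeegnerPoint N W K P) {k : ℤ} (hk : k ≠ 0) :
    IsHeegnerPoint N W K (k • P) := by
  obtain ⟨Dt, H, ι, hPt⟩ := hP
  have hk0 : k * Dt.c ≠ 0 := mul_ne_zero hk Dt.maninConstant_ne_zero_holds
  have hkΛ : ∀ z ∈ periodLattice Dt.f, ((k * Dt.c : ℤ) : ℂ) * z ∈ Dt.L.lattice := by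
    intro z hz
    have h := Dt.smul_periodLattice_le z hz
    have : ((k * Dt.c : ℤ) : ℂ) * z = k • ((Dt.c : ℂ) * z) := by
      rw [zsmul_eq_mul]; push_cast; ring
    rw [this]
    exact Dt.L.lattice.smul_mem k h
  obtain ⟨Dk, hf, -, hu, hc⟩ := Dt.exists_datum_c_eq hk0 hkΛ
  refine ⟨Dk, H, ι, ?_⟩
  rw [map_zsmul, hPt, heegnerPointComplex_eq_zsmul Dt Dk k hf hu hc H]

end Scaling

/-! ### 2. The index of `ℤ(n•x)` -/

/-- For `x` of infinite order in an additive commutative group and an integer `n`: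
`[G : ℤ(n•x)] = |n| · [G : ℤx]` (`ℤ(n•x) ≤ ℤx` with relative index `[ℤx : ℤ(n•x)] = |n|`, computed
in `ℤ ≅ ℤx`; indices as `Nat.card`, so both sides are `0` when `G/ℤx` is infinite, and for `n = 0`
both sides are `0` because `G ∋ x` is infinite). [folklore] -/
theorem index_zmultiples_zsmul {G : Type*} [AddCommGroup G] {x : G} (hx : ¬ IsOfFinAddOrder x)
    (n : ℤ) :
    (AddSubgroup.zmultiples (n • x)).index = n.natAbs * (AddSubgroup.zmultiples x).index := by
  set e : ℤ →+ G := zmultiplesHom G x with he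
  have hle : AddSubgroup.zmultiples (n • x) ≤ AddSubgroup.zmultiples x :=
    AddSubgroup.zmultiples_le_of_mem (AddSubgroup.zsmul_mem _ (AddSubgroup.mem_zmultiples x) n)
  -- `[G : ℤ(n•x)] = [ℤx : ℤ(n•x)] · [G : ℤx]`
  rw [← AddSubgroup.relIndex_mul_index hle]
  congr 1
  -- the relative index, computed by pulling back along `ℤ → G`, `m ↦ m • x`
  have hcomap : (AddSubgroup.zmultiples (n • x)).comap e = AddSubgroup.zmultiples n := by
    ext m
    simp only [AddSubgroup.mem_comap, he, zmultiplesHom_apply, AddSubgroup.mem_zmultiples_iff]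
    constructor
    · rintro ⟨j, hj⟩
      refine ⟨j, ?_⟩
      have h1 : (j * n) • x = m • x := by rw [mul_smul, hj]
      have h2 : (j * n - m) • x = 0 := by rw [sub_smul, h1, sub_self]
      by_contra hne
      have hne' : j * n - m ≠ 0 := by
        intro h0; exact hne (by rw [smul_eq_mul]; linarith [sub_eq_zero.mp h0])
      exact hx (isOfFinAddOrder_iff_zsmul_eq_zero.mpr ⟨j * n - m, hne', h2⟩)
    · rintro ⟨j, rfl⟩
      exact ⟨j, by rw [smul_eq_mul, mul_smul]⟩
  have hrange : e.range = AddSubgroup.zmultiples x := by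
    rw [he, AddSubgroup.range_zmultiplesHom]
  rw [← hrange, ← AddSubgroup.index_comap, hcomap, Int.index_zmultiples]

/-! ### 3. The `∀ P, IsHeegnerPoint … P → …` form of link (B) is degenerate -/

/-- **The tree's wording of Castella 2018 §5 link (B) has no non-degenerate instance.** Granted the
named fact `Castella2018.section5_grossZagierParaphrase` (as landed in p201349: conclusion
`ord_p qv + ord_p qdv = 2·ord_p [E(K) : ℤP]` for EVERY Heegner point `P` in the sense
`IsHeegnerPoint N_E W K P` of infinite order), ANY instance of its hypotheses — `W` semistable,
`p > 3`, `r_an = 1`, `E[p]` irreducible, `q ≠ p` multiplicative with `p ∤ v_q(Δ)`, `K` imaginary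
quadratic with `q` ramified and the other primes of `N` and `p` split, `L(E^D,1) ≠ 0`, a Heegner
point `P` of infinite order, a minimal model `Wd` of the twist, rational values `qv`, `qdv` — in
which the index `[E(K) : ℤP]` is a POSITIVE integer (`hidx`; in §5's setting `rank_ℤ E(K) = 1` by
Gross–Zagier–Kolyvagin, so this is the case) is contradictory: `p • P` is again such a Heegner point
(`isHeegnerPoint_zsmul`) with index `p·[E(K):ℤP]` (`index_zmultiples_zsmul`), and the fact assigns
both `P` and `p • P` the same left-hand side. The published statement (Castella §5 after
Jetchev–Skinner–Wan §7.4, `⟨z_K,z_K⟩/c_E²` with `p ∤ c_E`) concerns the Heegner point of a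
parametrisation with `p`-unit Manin constant; the repair is to carry the datum and `¬ p ∣ Dt.c`
(module docstring). [cite: Castella2018, §5 (arXiv:1704.06608 p. 12), Gross–Zagier paraphrase]
[cite: JetchevSkinnerWan2017, §7.4 Remark 43 and the display before (7.22)] -/
theorem section5_grossZagierParaphrase_degenerate
    (hB : Castella2018.section5_grossZagierParaphrase)
    (W : WeierstrassCurve ℚ) [W.IsElliptic] [W.IsGloballyMinimal] [NeZero (W.conductorNorm ℤ)]
    (p q : ℕ) [Fact p.Prime] [Fact q.Prime] (K : Type) [Field K] [NumberField K]
    (P : (W.baseChange K).toAffine.Point) (Wd : WeierstrassCurve ℚ) [Wd.IsElliptic]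
    [Wd.IsGloballyMinimal]
    (hsst : Semistable W) (hp : 3 < p) (hr : W.analyticRank = 1)
    (hirr : W.HasIrreducibleModPGaloisRep p) (hqp : q ≠ p)
    (hmq : W.HasMultiplicativeReductionAtPrime q)
    (hvq : ¬ p ∣ padicValInt q W.minimalDiscriminantInt)
    (hK : IsImaginaryQuadratic K) (hqD : (q : ℤ) ∣ NumberField.discr K)
    (hsplit : ∀ ℓ : ℕ, ℓ.Prime → ℓ ∣ W.conductorNorm ℤ → ℓ ≠ q →
      ((Ideal.span {(ℓ : ℤ)}).primesOver (𝓞 K)).ncard = 2)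
    (hps : ((Ideal.span {(p : ℤ)}).primesOver (𝓞 K)).ncard = 2)
    (hL : (W.quadraticTwist (NumberField.discr K : ℚ)).entireLFunction 1 ≠ 0)
    (hP : IsHeegnerPoint (W.conductorNorm ℤ) W K P) (hnt : ¬ IsOfFinAddOrder P)
    (hWd : ∃ C : VariableChange ℚ, C • W.quadraticTwist (NumberField.discr K : ℚ) = Wd)
    (qv qdv : ℚ) (hqv : W.leadingLCoeff / ((W.realPeriodRat * W.regulator : ℝ) : ℂ) = (qv : ℂ))
    (hqdv : Wd.entireLFunction 1 / (Wd.realPeriodRat : ℂ) = (qdv : ℂ))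
    (hidx : (AddSubgroup.zmultiples P).index ≠ 0) : False := by
  have hp0 : (p : ℤ) ≠ 0 := by exact_mod_cast (Fact.out : p.Prime).ne_zero
  -- the fact at `P`
  have h1 := hB W p q K P Wd hsst hp hr hirr hqp hmq hvq hK hqD hsplit hps hL hP hnt hWd qv qdv
    hqv hqdv
  -- the fact at `p • P`, again a Heegner point of infinite order
  have hP' : IsHeegnerPoint (W.conductorNorm ℤ) W K ((p : ℤ) • P) := isHeegnerPoint_zsmul hP hp0
  have hnt' : ¬ IsOfFinAddOrder ((p : ℤ) • P) := fun h ↦ hnt (isOfFinAddOrder_of_zsmul hp0 h)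
  have h2 := hB W p q K ((p : ℤ) • P) Wd hsst hp hr hirr hqp hmq hvq hK hqD hsplit hps hL hP' hnt'
    hWd qv qdv hqv hqdv
  -- the two indices differ by the factor `p`
  have hind : (AddSubgroup.zmultiples ((p : ℤ) • P)).index =
      p * (AddSubgroup.zmultiples P).index := by
    rw [index_zmultiples_zsmul hnt (p : ℤ), Int.natAbs_natCast]
  have hval : padicValNat p (AddSubgroup.zmultiples ((p : ℤ) • P)).index =
      padicValNat p (AddSubgroup.zmultiples P).index + 1 := by
    rw [hind, padicValNat.mul (Fact.out : p.Prime).ne_zero hidx, padicValNat_self]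
    ring
  rw [h1, hval] at h2
  push_cast at h2
  omega

/-- The same degeneracy, positively: granted the fact as worded, in every instance of its
hypotheses the subgroup `ℤP` has index `0`, i.e. `E(K)/ℤP` is infinite — incompatible with
`rank_ℤ E(K) = 1`, which holds in Castella's §5 setting (Gross–Zagier–Kolyvagin). [cite: Castella2018, §5 (arXiv:1704.06608 p. 12)] -/
theorem index_eq_zero_of_section5_grossZagierParaphrase
    (hB : Castella2018.section5_grossZagierParaphrase)
    (W : WeierstrassCurve ℚ) [W.IsElliptic] [W.IsGloballyMinimal] [NeZero (W.conductorNorm ℤ)]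
    (p q : ℕ) [Fact p.Prime] [Fact q.Prime] (K : Type) [Field K] [NumberField K]
    (P : (W.baseChange K).toAffine.Point) (Wd : WeierstrassCurve ℚ) [Wd.IsElliptic]
    [Wd.IsGloballyMinimal]
    (hsst : Semistable W) (hp : 3 < p) (hr : W.analyticRank = 1)
    (hirr : W.HasIrreducibleModPGaloisRep p) (hqp : q ≠ p)
    (hmq : W.HasMultiplicativeReductionAtPrime q)
    (hvq : ¬ p ∣ padicValInt q W.minimalDiscriminantInt)
    (hK : IsImaginaryQuadratic K) (hqD : (q : ℤ) ∣ NumberField.discr K)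
    (hsplit : ∀ ℓ : ℕ, ℓ.Prime → ℓ ∣ W.conductorNorm ℤ → ℓ ≠ q →
      ((Ideal.span {(ℓ : ℤ)}).primesOver (𝓞 K)).ncard = 2)
    (hps : ((Ideal.span {(p : ℤ)}).primesOver (𝓞 K)).ncard = 2)
    (hL : (W.quadraticTwist (NumberField.discr K : ℚ)).entireLFunction 1 ≠ 0)
    (hP : IsHeegnerPoint (W.conductorNorm ℤ) W K P) (hnt : ¬ IsOfFinAddOrder P)
    (hWd : ∃ C : VariableChange ℚ, C • W.quadraticTwist (NumberField.discr K : ℚ) = Wd)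
    (qv qdv : ℚ) (hqv : W.leadingLCoeff / ((W.realPeriodRat * W.regulator : ℝ) : ℂ) = (qv : ℂ))
    (hqdv : Wd.entireLFunction 1 / (Wd.realPeriodRat : ℂ) = (qdv : ℂ)) :
    (AddSubgroup.zmultiples P).index = 0 := by
  by_contra hidx
  exact section5_grossZagierParaphrase_degenerate hB W p q K P Wd hsst hp hr hirr hqp hmq hvq hK hqD
    hsplit hps hL hP hnt hWd qv qdv hqv hqdv hidx

end Summit.BirchSwinnertonDyer.Rank1Residual.X11b

end
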